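import Mathlib
import Literature.NumberTheory.Irrationality.DirichletLValues.ChowlaMilnorEvenProofs
import Literature.NumberTheory.Irrationality.DirichletLValues.HurwitzCorollary2Proofs
import Literature.NumberTheory.Transcendental.PeriodsWave0
import HarnessLib

/-!
# The Chowla–Milnor space `V_k(q)`: the coprime sum `Σ_{(a,q)=1} ζ(k,a/q) = J_k(q)·ζ(k)` and `V_k^+(q) ≤ V_k(q)`

Topic `Literature/NumberTheory/Irrationality/DirichletLValues`. Proofs-only companion of `ChowlaMilnor.lean` (the ODD
space `V_k^−(q)`, Lai–Li) and of `ChowlaMilnorEvenProofs.lean` (`dim_ℚ V_k^+(q) = φ(q)/2`,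
`V_k^+(q) ⊂ (2πi)^k·ℚ(e^{2πi/q})`); first of two files formalising the UNCONDITIONAL half of S. Gun, M. R. Murty,
P. Rath, *On a conjecture of Chowla and Milnor*, Canad. J. Math. **63** (2011) 1328–1344 [GunRammurtyRath2011]
(Theorem 2 and Corollary 1 are assembled in `ChowlaMilnorCoprimeModuliProofs.lean`). Read on the page:

* Definition 1 (p. 1329): "`V_k(q) = ℚ`-Span of `{ζ(k, a/q) : 1 ≤ a < q, (a, q) = 1}`"; the Chowla–Milnor
  conjecture (OPEN, not typed anywhere in the tree) asserts `dim_ℚ V_k(q) = φ(q)`; Theorem 1: `dim_ℚ V_k(q) ≥ φ(q)/2`.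
* Proof of Theorem 2 (p. 1334): "Suppose that `dim_ℚ V_k(q) = φ(q)/2`. Then the numbers `ζ(k, a/q) − ζ(k, 1 − a/q)`,
  where `(a,q) = 1`, `1 ≤ a < q/2` generate `V_k(q)`. Now `q^k ζ(k) ∏_{p∣q} (1 − p^{−k}) = Σ_{(a,q)=1} ζ(k, a/q) ∈ V_k(q)`
  and hence `ζ(k) = (2πi)^k Σ Z_k(a,q) λ_a`, `λ_a ∈ ℚ`."

## What is proved (theorems only; no definition is introduced)

`V_k(q)` is WRITTEN OUT as `Submodule.span ℚ {y | ∃ a, 1 ≤ a ∧ a < q ∧ Nat.Coprime a q ∧ y = hurwitzValue k (a/q)}`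
with the existing real Hurwitz value `hurwitzValue s x = Σ_{n≥0} (n+x)^{−s}` (`LinearIndependence.lean`), in the
style of `ChowlaMilnorEvenProofs.lean` (whose `V_k^+(q)` rendering is reused verbatim).

* `hurwitzValue_pos`, `hurwitzValue_lt_of_lt`, `hurwitzValue_one`, `zetaValue_pos_of_two_le` — positivity,
  strict decrease in `x`, `ζ(k,1) = ζ(k)`;
* `sum_hurwitzValue_div_eq` — the distribution relation `Σ_{b=1}^{m} ζ(k, b/m) = m^k ζ(k)` (residue classes in
  `Σ_N N^{−k}`, Mathlib `Nat.sumByResidueClasses` + the tree's `hasSum_progression_hurwitzValue`);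
* `sum_coprime_hurwitzValue_eq` — `Σ_{1 ≤ a ≤ q, (a,q)=1} ζ(k, a/q) = J·ζ(k)` with the INTEGER
  `J = J_k(q) = Σ_{d ∣ q} μ(d) (q/d)^k` (Möbius inversion on the finite side; `=` the printed
  `q^k ∏_{p∣q}(1 − p^{−k})`), and `jordan_pos : 0 < J` (from the term `ζ(k,1/q) > 0`; no Euler product is used);
* `hurwitzValue_mem_span`, `span_hurwitzEven_le_span`, `span_hurwitzEven_eq_span_of_finrank_le` —
  `V_k^+(q) ≤ V_k(q)`, with equality as soon as `dim V_k(q) ≤ φ(q)/2` (Okada, via `finrank_span_hurwitzEven`);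
* **`zetaValue_mem_cyclotomic_of_finrank_le`** — if `dim_ℚ V_k(q) ≤ φ(q)/2` (`k ≥ 2`, `q ≥ 3`) then
  `ζ(k) ∈ (2πi)^k · ℚ(e^{2πi/q})` (the display above; the argument is parity-free).

HONEST FRAMING (cells pub-zeta5 / zeta5-irr): kernel theorems of PRINTED, UNCONDITIONAL statements; net named-fact
debt 0 (nothing introduced or discharged); the Chowla–Milnor conjecture stays OPEN and untyped; nothing here
concerns `ζ(5)`'s irrationality.
-/

noncomputable section

open Finset Complex Polynomial

open scoped Nat

namespace Literature.NumberTheory.Irrationality.DirichletLValues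

open Literature.NumberTheory.Transcendental

/-! ### Positivity, the value at `1`, the distribution relation -/

/-- Summability of the real Hurwitz series `Σ_{n ≥ 0} (n + x)^{−k}` for `x > 0`, `k ≥ 2`. [folklore] -/
private theorem summable_hurwitz {x : ℝ} (hx : 0 < x) {k : ℕ} (hk : 2 ≤ k) :
    Summable (fun n : ℕ => 1 / ((n : ℝ) + x) ^ k) := by
  have h := (Real.summable_one_div_nat_add_rpow x k).2 (by exact_mod_cast hk)
  refine h.congr fun n => ?_
  rw [abs_of_pos (by positivity), Real.rpow_natCast]

/-- `ζ(k, x) > 0` for `x > 0`, `k ≥ 2` (a convergent series of positive terms).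
[cite: GunRammurtyRath2011, §1 (p. 1328), definition of ζ(s, x)] -/
theorem hurwitzValue_pos {x : ℝ} (hx : 0 < x) {k : ℕ} (hk : 2 ≤ k) : 0 < hurwitzValue k x := by
  unfold hurwitzValue
  exact (summable_hurwitz hx hk).tsum_pos (fun n => by positivity) 0 (by positivity)

/-- `ζ(k, ·)` is strictly decreasing in the second variable: `ζ(k, x) > ζ(k, y)` for `0 < x < y`, `k ≥ 2`.
[cite: GunRammurtyRath2011, §1 (p. 1328), definition of ζ(s, x)] -/
theorem hurwitzValue_lt_of_lt {x y : ℝ} (hx : 0 < x) (hxy : x < y) {k : ℕ} (hk : 2 ≤ k) :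
    hurwitzValue k y < hurwitzValue k x := by
  unfold hurwitzValue
  have hy : 0 < y := hx.trans hxy
  refine Summable.tsum_lt_tsum (i := 0) (fun n => ?_) ?_ (summable_hurwitz hy hk) (summable_hurwitz hx hk)
  · exact one_div_le_one_div_of_le (by positivity) (by gcongr)
  · exact one_div_lt_one_div_of_lt (by positivity) (by gcongr)

/-- `ζ(k, 1) = ζ(k)` (`k ≥ 2`): the tree's `zetaValue k = Σ_{n ≥ 0} n^{−k}` has the junk summand `0^{−k} = 0`.
[cite: GunRammurtyRath2011, §1 (p. 1328): "for x = 1, Hurwitz zeta function is the classical Riemann zeta function"] -/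
theorem hurwitzValue_one {k : ℕ} (hk : 2 ≤ k) : hurwitzValue k 1 = zetaValue k := by
  have hs : Summable (fun n : ℕ => 1 / (n : ℝ) ^ k) := Real.summable_one_div_nat_pow.mpr (by omega)
  rw [zetaValue, hs.tsum_eq_zero_add, hurwitzValue]
  have h0 : (1 : ℝ) / (((0 : ℕ) : ℝ)) ^ k = 0 := by
    rw [Nat.cast_zero, zero_pow (by omega), div_zero]
  rw [h0, zero_add]
  refine tsum_congr fun n => ?_
  push_cast
  ring

/-- `ζ(k) = ζ(k, 1) > 0` for `k ≥ 2`.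
[cite: GunRammurtyRath2011, §1 (p. 1328): ζ(s, x) at x = 1 "is the classical Riemann zeta function"] -/
theorem zetaValue_pos_of_two_le {k : ℕ} (hk : 2 ≤ k) : 0 < zetaValue k := by
  rw [← hurwitzValue_one hk]
  exact hurwitzValue_pos one_pos hk

/-- One residue class of `Σ_{N ≥ 1} N^{−k}`: for `1 ≤ u`, `1 ≤ m`,
`Σ_{n ≥ 0} (u + m n)^{−k} = m^{−k} ζ(k, u/m)`. [folklore] -/
private theorem tsum_progression_eq {u m k : ℕ} (hu : 1 ≤ u) (hm : 1 ≤ m) (hk : 2 ≤ k) :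
    ∑' n : ℕ, 1 / (((u + m * n : ℕ) : ℝ)) ^ k = 1 / (m : ℝ) ^ k * hurwitzValue k ((u : ℝ) / m) := by
  rw [← (hasSum_progression_hurwitzValue hu hm hk).tsum_eq]
  refine tsum_congr fun n => ?_
  rw [mul_comm m n]

/-- **Distribution relation** `Σ_{b=1}^{m} ζ(k, b/m) = m^k ζ(k)` (`m ≥ 1`, `k ≥ 2`): the residue classes `b mod m`
partition `Σ_{N ≥ 1} N^{−k}`. (The case used in print: "`(p^k − 1)ζ(k) = Σ_{a=1}^{p−1} ζ(k, a/p)`", p. 1329, and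
"`(4^k − 1)ζ(k) = ζ(k,1/4) + ζ(k,3/4) + (2^k − 1)ζ(k)`", p. 1343.)
[cite: GunRammurtyRath2011, p. 1329 (display before Milnor's conjecture)] -/
theorem sum_hurwitzValue_div_eq {m k : ℕ} (hm : 1 ≤ m) (hk : 2 ≤ k) :
    ∑ b ∈ Finset.Ioc 0 m, hurwitzValue k ((b : ℝ) / m) = (m : ℝ) ^ k * zetaValue k := by
  obtain ⟨n, rfl⟩ : ∃ n, m = n + 1 := ⟨m - 1, by omega⟩
  have hf : Summable (fun N : ℕ => 1 / (N : ℝ) ^ k) := Real.summable_one_div_nat_pow.mpr (by omega)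
  have hm0 : (0 : ℝ) < (n + 1 : ℕ) := by positivity
  have hmk : ((n + 1 : ℕ) : ℝ) ^ k ≠ 0 := pow_ne_zero _ hm0.ne'
  -- split `ζ(k)` along the residue classes mod `n + 1`
  have hsplit : zetaValue k = ∑ j : ZMod (n + 1), ∑' x : ℕ, 1 / (((j.val + (n + 1) * x : ℕ) : ℝ)) ^ k := by
    rw [zetaValue, Nat.sumByResidueClasses hf (n + 1)]
  have hfin : (∑ j : ZMod (n + 1), ∑' x : ℕ, 1 / (((j.val + (n + 1) * x : ℕ) : ℝ)) ^ k) =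
      ∑ i ∈ Finset.range (n + 1), ∑' x : ℕ, 1 / (((i + (n + 1) * x : ℕ) : ℝ)) ^ k :=
    Fin.sum_univ_eq_sum_range (fun i => ∑' x : ℕ, 1 / (((i + (n + 1) * x : ℕ) : ℝ)) ^ k) (n + 1)
  -- the class `0`: shift by one, it is the progression of `b = n + 1`
  have hzero : ∑' x : ℕ, 1 / (((0 + (n + 1) * x : ℕ) : ℝ)) ^ k =
      1 / ((n + 1 : ℕ) : ℝ) ^ k * hurwitzValue k (((n + 1 : ℕ) : ℝ) / (n + 1 : ℕ)) := by
    have hs : Summable (fun x : ℕ => 1 / (((0 + (n + 1) * x : ℕ) : ℝ)) ^ k) := by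
      have := hf.comp_injective (f := fun N : ℕ => 1 / (N : ℝ) ^ k)
        (show Function.Injective (fun x : ℕ => 0 + (n + 1) * x) from fun a b h => by simpa using h)
      exact this
    rw [hs.tsum_eq_zero_add]
    have h0 : (1 : ℝ) / (((0 + (n + 1) * 0 : ℕ) : ℝ)) ^ k = 0 := by
      rw [mul_zero, add_zero, Nat.cast_zero, zero_pow (by omega), div_zero]
    rw [h0, zero_add, ← tsum_progression_eq (u := n + 1) (m := n + 1) (by omega) (by omega) hk]
    refine tsum_congr fun x => ?_
    congr 3
    ring
  -- the classes `1 ≤ i ≤ n`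
  have hpos : ∀ i ∈ Finset.range n, ∑' x : ℕ, 1 / ((((i + 1) + (n + 1) * x : ℕ) : ℝ)) ^ k =
      1 / ((n + 1 : ℕ) : ℝ) ^ k * hurwitzValue k (((i + 1 : ℕ) : ℝ) / (n + 1 : ℕ)) := by
    intro i _
    exact tsum_progression_eq (u := i + 1) (m := n + 1) (by omega) (by omega) hk
  -- `Σ_{b ∈ (0, N]} G b = Σ_{i < N} G (i+1)`
  have hshift : ∀ N : ℕ, ∑ b ∈ Finset.Ioc 0 N, hurwitzValue k ((b : ℝ) / (n + 1 : ℕ)) =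
      ∑ i ∈ Finset.range N, hurwitzValue k (((i + 1 : ℕ) : ℝ) / (n + 1 : ℕ)) := by
    intro N
    induction N with
    | zero => simp
    | succ N ih => rw [Finset.sum_Ioc_succ_top (Nat.zero_le N), ih, Finset.sum_range_succ]
  -- assemble
  rw [hsplit, hfin, Finset.sum_range_succ', hzero, Finset.sum_congr rfl hpos, hshift, ← Finset.mul_sum,
    ← mul_add, ← mul_assoc, mul_one_div_cancel hmk, one_mul, Finset.sum_range_succ]

/-! ### The coprime sum `Σ_{(a,q)=1} ζ(k, a/q) = J·ζ(k)`, `J = Σ_{d ∣ q} μ(d)(q/d)^k > 0` -/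

/-- `Σ_{d ∣ n} μ(d) = [n = 1]` (Möbius inversion of the constant function `1`; Mathlib's `μ * ζ = 1`).
[folklore] -/
private theorem sum_divisors_moebius (n : ℕ) :
    ∑ d ∈ n.divisors, (ArithmeticFunction.moebius d : ℤ) = if n = 1 then 1 else 0 := by
  have h : (ArithmeticFunction.moebius * ((ArithmeticFunction.zeta : ArithmeticFunction ℕ) : ArithmeticFunction ℤ)) n =
      (1 : ArithmeticFunction ℤ) n := by
    rw [ArithmeticFunction.moebius_mul_coe_zeta]
  rwa [ArithmeticFunction.coe_mul_zeta_apply, ArithmeticFunction.one_apply] at h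

/-- The coprimality indicator as a Möbius sum: `[gcd(a,q) = 1] = Σ_{d ∣ gcd(a,q)} μ(d)`. [folklore] -/
private theorem ite_coprime_eq_sum_moebius (a q : ℕ) :
    (if a.Coprime q then (1 : ℝ) else 0) = ∑ d ∈ (Nat.gcd a q).divisors, ((ArithmeticFunction.moebius d : ℤ) : ℝ) := by
  rw [← Int.cast_sum, sum_divisors_moebius]
  by_cases h : a.Coprime q
  · rw [if_pos h, if_pos (Nat.coprime_iff_gcd_eq_one.1 h), Int.cast_one]
  · rw [if_neg h, if_neg (mt Nat.coprime_iff_gcd_eq_one.2 h), Int.cast_zero]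

/-- Reindexing the multiples of `d` in `(0, q]`: `Σ_{a ≤ q, d ∣ a} F(a) = Σ_{b ≤ q/d} F(d b)` (`d ∣ q`, `q ≠ 0`).
[folklore] -/
private theorem sum_filter_dvd_Ioc {q d : ℕ} (hq : q ≠ 0) (hd : d ∣ q) (F : ℕ → ℝ) :
    ∑ a ∈ (Finset.Ioc 0 q).filter (fun a => d ∣ a), F a = ∑ b ∈ Finset.Ioc 0 (q / d), F (d * b) := by
  have hd0 : d ≠ 0 := by rintro rfl; exact hq (zero_dvd_iff.1 hd)
  symm
  refine Finset.sum_bij (fun b _ => d * b) ?_ ?_ ?_ ?_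
  · intro b hb
    simp only [Finset.mem_Ioc] at hb
    simp only [Finset.mem_filter, Finset.mem_Ioc]
    refine ⟨⟨Nat.mul_pos (Nat.pos_of_ne_zero hd0) hb.1, ?_⟩, dvd_mul_right d b⟩
    calc d * b ≤ d * (q / d) := Nat.mul_le_mul_left d hb.2
      _ = q := Nat.mul_div_cancel' hd
  · intro b₁ _ b₂ _ h
    exact Nat.eq_of_mul_eq_mul_left (Nat.pos_of_ne_zero hd0) h
  · intro a ha
    simp only [Finset.mem_filter, Finset.mem_Ioc] at ha
    obtain ⟨⟨ha0, haq⟩, ⟨b, rfl⟩⟩ := ha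
    refine ⟨b, ?_, rfl⟩
    simp only [Finset.mem_Ioc]
    refine ⟨Nat.pos_of_ne_zero (by rintro rfl; simp at ha0), ?_⟩
    exact (Nat.le_div_iff_mul_le (Nat.pos_of_ne_zero hd0)).2 (by rwa [mul_comm] at haq)
  · intro b _
    rfl

/-- **The coprime sum**: for `q ≥ 1`, `k ≥ 2`,
`Σ_{1 ≤ a ≤ q, (a,q) = 1} ζ(k, a/q) = J_k(q) · ζ(k)` with the integer `J_k(q) = Σ_{d ∣ q} μ(d) (q/d)^k`
(`= q^k ∏_{p ∣ q} (1 − p^{−k})`, Jordan's totient) — the display "`q^k ζ(k) ∏_{p∣q}(1 − p^{−k}) = Σ_{(a,q)=1} ζ(k, a/q)`"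
of the proof of Theorem 2, obtained here by Möbius inversion `[(a,q) = 1] = Σ_{d ∣ (a,q)} μ(d)` and the distribution
relation at the moduli `q/d`. [cite: GunRammurtyRath2011, proof of Theorem 2 (p. 1334, display)] -/
theorem sum_coprime_hurwitzValue_eq {q k : ℕ} (hq : 1 ≤ q) (hk : 2 ≤ k) :
    ∑ a ∈ (Finset.Ioc 0 q).filter (fun a => a.Coprime q), hurwitzValue k ((a : ℝ) / q) =
      ((∑ d ∈ q.divisors, (ArithmeticFunction.moebius d : ℤ) * ((q / d : ℕ) : ℤ) ^ k : ℤ) : ℝ) * zetaValue k := by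
  have hq0 : q ≠ 0 := by omega
  calc ∑ a ∈ (Finset.Ioc 0 q).filter (fun a => a.Coprime q), hurwitzValue k ((a : ℝ) / q)
      = ∑ a ∈ Finset.Ioc 0 q, (if a.Coprime q then (1 : ℝ) else 0) * hurwitzValue k ((a : ℝ) / q) := by
        rw [Finset.sum_filter]
        refine Finset.sum_congr rfl fun a _ => ?_
        split_ifs <;> simp
    _ = ∑ a ∈ Finset.Ioc 0 q, ∑ d ∈ (Nat.gcd a q).divisors,
          ((ArithmeticFunction.moebius d : ℤ) : ℝ) * hurwitzValue k ((a : ℝ) / q) := by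
        refine Finset.sum_congr rfl fun a _ => ?_
        rw [ite_coprime_eq_sum_moebius, Finset.sum_mul]
    _ = ∑ d ∈ q.divisors, ∑ a ∈ (Finset.Ioc 0 q).filter (fun a => d ∣ a),
          ((ArithmeticFunction.moebius d : ℤ) : ℝ) * hurwitzValue k ((a : ℝ) / q) := by
        refine Finset.sum_comm' fun a d => ?_
        simp only [Nat.mem_divisors, Finset.mem_filter, Finset.mem_Ioc]
        constructor
        · rintro ⟨ha, hd, -⟩
          exact ⟨⟨ha, (Nat.dvd_gcd_iff.1 hd).1⟩, (Nat.dvd_gcd_iff.1 hd).2, hq0⟩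
        · rintro ⟨⟨ha, hda⟩, hdq, -⟩
          exact ⟨ha, Nat.dvd_gcd hda hdq, (Nat.gcd_pos_of_pos_right a (Nat.pos_of_ne_zero hq0)).ne'⟩
    _ = ∑ d ∈ q.divisors, ((ArithmeticFunction.moebius d : ℤ) : ℝ) *
          ∑ b ∈ Finset.Ioc 0 (q / d), hurwitzValue k ((b : ℝ) / ((q / d : ℕ) : ℝ)) := by
        refine Finset.sum_congr rfl fun d hd => ?_
        have hdq : d ∣ q := Nat.dvd_of_mem_divisors hd
        have hd0 : d ≠ 0 := by rintro rfl; exact hq0 (zero_dvd_iff.1 hdq)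
        rw [← Finset.mul_sum, sum_filter_dvd_Ioc hq0 hdq]
        congr 1
        refine Finset.sum_congr rfl fun b _ => ?_
        congr 1
        have e : (q : ℝ) = (d : ℝ) * ((q / d : ℕ) : ℝ) := by
          rw [← Nat.cast_mul, Nat.mul_div_cancel' hdq]
        rw [e, Nat.cast_mul, mul_div_mul_left _ _ (by exact_mod_cast hd0 : (d : ℝ) ≠ 0)]
    _ = ∑ d ∈ q.divisors, ((ArithmeticFunction.moebius d : ℤ) : ℝ) * (((q / d : ℕ) : ℝ) ^ k * zetaValue k) := by
        refine Finset.sum_congr rfl fun d hd => ?_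
        have hdq : d ∣ q := Nat.dvd_of_mem_divisors hd
        have hd0 : d ≠ 0 := by rintro rfl; exact hq0 (zero_dvd_iff.1 hdq)
        rw [sum_hurwitzValue_div_eq (Nat.div_pos (Nat.le_of_dvd (Nat.pos_of_ne_zero hq0) hdq)
          (Nat.pos_of_ne_zero hd0)) hk]
    _ = _ := by
        rw [Int.cast_sum, Finset.sum_mul]
        refine Finset.sum_congr rfl fun d _ => ?_
        rw [Int.cast_mul, Int.cast_pow, Int.cast_natCast]
        ring

/-- **`J_k(q) = Σ_{d ∣ q} μ(d)(q/d)^k > 0`** (`q ≥ 1`, `k ≥ 2`), WITHOUT the Euler product: `J_k(q)·ζ(k)` is the coprime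
sum, which is at least its term `ζ(k, 1/q) > 0`, and `ζ(k) > 0` — the positivity of the printed factor
`q^k ∏_{p∣q}(1 − p^{−k})` in "`q^k ζ(k) ∏_{p∣q}(1 − p^{−k}) = Σ_{(a,q)=1} ζ(k, a/q)`".
[cite: GunRammurtyRath2011, proof of Theorem 2 (p. 1334, display)] -/
theorem jordan_pos {q k : ℕ} (hq : 1 ≤ q) (hk : 2 ≤ k) :
    0 < ∑ d ∈ q.divisors, (ArithmeticFunction.moebius d : ℤ) * ((q / d : ℕ) : ℤ) ^ k := by
  have hq0 : (0 : ℝ) < q := by exact_mod_cast hq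
  have h1 : (1 : ℕ) ∈ (Finset.Ioc 0 q).filter (fun a => a.Coprime q) := by
    simp only [Finset.mem_filter, Finset.mem_Ioc]
    exact ⟨⟨Nat.one_pos, hq⟩, Nat.coprime_one_left q⟩
  have hS : 0 < ∑ a ∈ (Finset.Ioc 0 q).filter (fun a => a.Coprime q), hurwitzValue k ((a : ℝ) / q) := by
    refine lt_of_lt_of_le (hurwitzValue_pos (x := ((1 : ℕ) : ℝ) / q) (by positivity) hk)
      (Finset.single_le_sum (f := fun a : ℕ => hurwitzValue k ((a : ℝ) / q)) (fun a ha => ?_) h1)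
    have ha' : 0 < a := (Finset.mem_Ioc.1 (Finset.mem_filter.1 ha).1).1
    exact (hurwitzValue_pos (by positivity) hk).le
  rw [sum_coprime_hurwitzValue_eq hq hk] at hS
  exact_mod_cast (mul_pos_iff_of_pos_right (zetaValue_pos_of_two_le hk)).1 hS

/-! ### `V_k^+(q) ≤ V_k(q)`, with equality as soon as `dim_ℚ V_k(q) ≤ φ(q)/2` -/

/-- The generating set `{ζ(k, a/q) : 1 ≤ a < q, (a,q) = 1}` of `V_k(q)` is finite. [folklore] -/
private theorem finite_generators (k q : ℕ) :
    {y : ℝ | ∃ a : ℕ, 1 ≤ a ∧ a < q ∧ Nat.Coprime a q ∧ y = hurwitzValue k ((a : ℝ) / q)}.Finite := by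
  refine ((Set.finite_Iio q).image (fun a : ℕ => hurwitzValue k ((a : ℝ) / q))).subset ?_
  rintro y ⟨a, -, haq, -, rfl⟩
  exact ⟨a, haq, rfl⟩

/-- A generator `ζ(k, a/q)` lies in `V_k(q)`. [cite: GunRammurtyRath2011, Definition 1 (p. 1329)] -/
theorem hurwitzValue_mem_span {k q a : ℕ} (ha1 : 1 ≤ a) (haq : a < q) (hcop : Nat.Coprime a q) :
    hurwitzValue k ((a : ℝ) / q) ∈ Submodule.span ℚ {y : ℝ | ∃ a : ℕ, 1 ≤ a ∧ a < q ∧ Nat.Coprime a q ∧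
        y = hurwitzValue k ((a : ℝ) / q)} :=
  Submodule.subset_span ⟨a, ha1, haq, hcop, rfl⟩

/-- **`V_k^+(q) ≤ V_k(q)`**: each `ζ(k, a/q) + (−1)^k ζ(k, 1 − a/q)` is `ζ(k, a/q) + (−1)^k ζ(k, (q−a)/q)` with
`(q − a, q) = 1` (the two spanning families of the proof of Theorem 1, p. 1332).
[cite: GunRammurtyRath2011, proof of Theorem 1 (p. 1332)] -/
theorem span_hurwitzEven_le_span {k q : ℕ} (hq : 2 ≤ q) :
    Submodule.span ℚ {y : ℝ | ∃ a : ℕ, 1 ≤ a ∧ 2 * a < q ∧ Nat.Coprime a q ∧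
        y = hurwitzValue k ((a : ℝ) / q) + (-1 : ℝ) ^ k * hurwitzValue k (1 - (a : ℝ) / q)} ≤
      Submodule.span ℚ {y : ℝ | ∃ a : ℕ, 1 ≤ a ∧ a < q ∧ Nat.Coprime a q ∧ y = hurwitzValue k ((a : ℝ) / q)} := by
  refine Submodule.span_le.2 ?_
  rintro y ⟨a, ha1, h2a, hcop, rfl⟩
  have haq : a < q := by omega
  have hq0 : (q : ℝ) ≠ 0 := by exact_mod_cast (show q ≠ 0 by omega)
  have hcop' : Nat.Coprime (q - a) q := (Nat.coprime_self_sub_left haq.le).2 hcop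
  have e : (1 : ℝ) - (a : ℝ) / q = ((q - a : ℕ) : ℝ) / q := by
    rw [Nat.cast_sub haq.le]
    field_simp
  rw [e]
  refine Submodule.add_mem _ (hurwitzValue_mem_span ha1 haq hcop) ?_
  rw [show (-1 : ℝ) ^ k * hurwitzValue k (((q - a : ℕ) : ℝ) / q) =
      ((-1 : ℚ) ^ k) • hurwitzValue k (((q - a : ℕ) : ℝ) / q) by rw [Rat.smul_def]; push_cast; rfl]
  exact Submodule.smul_mem _ _ (hurwitzValue_mem_span (by omega) (by omega) hcop')

/-- **Equality when the dimension is minimal**: for `k ≥ 2`, `q ≥ 3`, if `dim_ℚ V_k(q) ≤ φ(q)/2` then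
`V_k^+(q) = V_k(q)` ("Suppose that `dim_ℚ V_k(q) = φ(q)/2`. Then the numbers `ζ(k, a/q) − ζ(k, 1 − a/q)` …
generate `V_k(q)`", p. 1334 — for odd `k` the `+`-family with its sign `(−1)^k` IS that family), since
`dim_ℚ V_k^+(q) = φ(q)/2` (`finrank_span_hurwitzEven`, Okada). [cite: GunRammurtyRath2011, proof of Theorem 2 (p. 1334)] -/
theorem span_hurwitzEven_eq_span_of_finrank_le {k q : ℕ} (hk : 2 ≤ k) (hq : 3 ≤ q)
    (h : Module.finrank ℚ ↥(Submodule.span ℚ {y : ℝ | ∃ a : ℕ, 1 ≤ a ∧ a < q ∧ Nat.Coprime a q ∧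
        y = hurwitzValue k ((a : ℝ) / q)}) ≤ Nat.totient q / 2) :
    Submodule.span ℚ {y : ℝ | ∃ a : ℕ, 1 ≤ a ∧ 2 * a < q ∧ Nat.Coprime a q ∧
        y = hurwitzValue k ((a : ℝ) / q) + (-1 : ℝ) ^ k * hurwitzValue k (1 - (a : ℝ) / q)} =
      Submodule.span ℚ {y : ℝ | ∃ a : ℕ, 1 ≤ a ∧ a < q ∧ Nat.Coprime a q ∧ y = hurwitzValue k ((a : ℝ) / q)} := by
  haveI : FiniteDimensional ℚ ↥(Submodule.span ℚ {y : ℝ | ∃ a : ℕ, 1 ≤ a ∧ a < q ∧ Nat.Coprime a q ∧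
      y = hurwitzValue k ((a : ℝ) / q)}) := FiniteDimensional.span_of_finite ℚ (finite_generators k q)
  refine Submodule.eq_of_le_of_finrank_le (span_hurwitzEven_le_span (by omega)) ?_
  rw [finrank_span_hurwitzEven hk hq]
  exact h

/-- **`ζ(k) ∈ (2πi)^k · ℚ(e^{2πi/q})` when `dim_ℚ V_k(q) ≤ φ(q)/2`** (`k ≥ 2`, `q ≥ 3`): the coprime sum
`J_k(q)·ζ(k) = Σ_{(a,q)=1} ζ(k, a/q)` lies in `V_k(q) = V_k^+(q) ⊂ (2πi)^k·ℚ(e^{2πi/q})`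
(`span_hurwitzEven_subset_cyclotomic`) and `J_k(q)` is a non-zero rational — the display
"`ζ(k) = (2πi)^k Σ Z_k(a,q) λ_a`, `λ_a ∈ ℚ`" of the proof of Theorem 2 (for odd `k`; the argument is parity-free).
[cite: GunRammurtyRath2011, proof of Theorem 2 (pp. 1334–1335)] -/
theorem zetaValue_mem_cyclotomic_of_finrank_le {k q : ℕ} (hk : 2 ≤ k) (hq : 3 ≤ q)
    (h : Module.finrank ℚ ↥(Submodule.span ℚ {y : ℝ | ∃ a : ℕ, 1 ≤ a ∧ a < q ∧ Nat.Coprime a q ∧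
        y = hurwitzValue k ((a : ℝ) / q)}) ≤ Nat.totient q / 2) :
    ∃ z ∈ Algebra.adjoin ℚ ({Complex.exp (2 * Real.pi * I / q)} : Set ℂ),
      ((zetaValue k : ℝ) : ℂ) = (2 * Real.pi * I) ^ k * z := by
  set J : ℤ := ∑ d ∈ q.divisors, (ArithmeticFunction.moebius d : ℤ) * ((q / d : ℕ) : ℤ) ^ k with hJ
  have hJpos : 0 < J := jordan_pos (by omega) hk
  -- the coprime sum lies in `V_k(q)`
  have hmem : (J : ℝ) * zetaValue k ∈ Submodule.span ℚ {y : ℝ | ∃ a : ℕ, 1 ≤ a ∧ a < q ∧ Nat.Coprime a q ∧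
      y = hurwitzValue k ((a : ℝ) / q)} := by
    rw [hJ, ← sum_coprime_hurwitzValue_eq (by omega) hk]
    refine Submodule.sum_mem _ fun a ha => ?_
    obtain ⟨ha, hcop⟩ := Finset.mem_filter.1 ha
    obtain ⟨ha0, haq⟩ := Finset.mem_Ioc.1 ha
    have haq' : a < q := by
      refine lt_of_le_of_ne haq ?_
      rintro rfl
      rw [Nat.coprime_self] at hcop
      omega
    exact hurwitzValue_mem_span ha0 haq' hcop
  rw [← span_hurwitzEven_eq_span_of_finrank_le hk hq h] at hmem
  obtain ⟨z, hz, e⟩ := span_hurwitzEven_subset_cyclotomic hk hq hmem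
  refine ⟨((J : ℚ)⁻¹ : ℚ) • z, Subalgebra.smul_mem _ hz _, ?_⟩
  have hJ0 : (J : ℂ) ≠ 0 := by exact_mod_cast hJpos.ne'
  rw [Rat.smul_def]
  push_cast at e ⊢
  field_simp
  linear_combination e

end Literature.NumberTheory.Irrationality.DirichletLValues

end
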